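import Summits.QuantumFields.YangMills.Theorems.BalabanUVNodesN15KingModelCovariantDeterminantBounds
import Summits.QuantumFields.YangMills.Theorems.BalabanUVNodesN15KingModelCovariantSpectralBounds
import Summits.QuantumFields.YangMills.Theorems.BalabanUVNodesN15KingModelCovariantLinkDependence
import Summits.QuantumFields.YangMills.Theorems.BalabanUVNodesN15KingModelCovariantPairingBounds
import Summits.QuantumFields.YangMills.Theorems.BalabanUVNodesN15KingModelCovariantRandomWalk
import HarnessLib

/-!
# BalabanUVNodes ∕ N15 — THE KING-MODEL RUNG (PART Ͱ-i): PART Ͱ BY NAME — «THE CURVED CASE BY DOMINATION» IN TWO PACKAGE THEOREMS: what does NOT change when King's `A = 0` fine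
# covariance is minimally coupled to an arbitrary unitary link field (magnitudes, decay, norms, the normalisation window), and what the curved case ADDS (the holonomy gap)
# (Track A, DAG node N15 = NE2; FAN-OUT v1.1 §N15 s3 «KING-MODEL RUNG … the one-line statement of what the curved case adds»; count-neutral)

HONEST FRAMING.  Count-neutral (cell `pub-ymgap`, seat `pub-ymgap-dag-n15-e` g42; `--supports stmt-QuantumFields-27247 --as helper` = K3ᴬ, KEY MAP v3).  A conjunction of theorems
already in the tree (PARTS Ͱ-a…Ͱ-l of this rung), no new mathematics; one finite torus at fixed spacing; the FINE covariance layer only — NOT Bałaban's `G_k(U)`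
(averaging penalty not of Kato form, Ͱ-a header), NOT [B9] (3.42)∕(3.45); NOT a node discharge (N15 of record untouched); nothing continuum ∕ ℝ⁴ ∕ OS ∕ Clay.

* ★★★ **`king_covariant_domination_package`** — for every period vector `K` (all `K_μ ≥ 2`), `c ≥ 0`, `m² > 0`, non-empty fibre index `n`, and EVERY unitary link field `U`:
  (1) `M_1 = lapF ⊗ₖ 1` (Ͱ-a); (2) blockwise Kato domination `‖(G_U)_{xy}‖ ≤ G(x,y)` (Ͱ-b); (3) uniform exponential decay with King's constants (Ͱ-e); (4) row sums `≤ 1∕m²` (Ͱ-e);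
  (5) `‖G_U‖_{ℓ²→ℓ²} ≤ 1∕m²` (Ͱ-f); (6) the spectrum of `M_U` lies in King's band `[m², m²+4(d+1)c]` (Ͱ-f∕Ͱ-h); (7) the diamagnetic window
  `|T|⁻¹ln det lapF ≤ (|n||T|)⁻¹ln Re det M_U ≤ ln(m²+2(d+1)c)` (Ͱ-c); (8) pairing domination `|⟨f,G_Ug⟩| ≤ ⟨|f|,G|g|⟩` (Ͱ-h); (9) Lipschitz locality in the field with King-kernel
  weights (Ͱ-g); (10) the random walk representation `G_U = Σ_k D₀^{−(k+1)}T_U^k` entrywise, termwise dominated by King's (Ͱ-k∕Ͱ-l, [B9] p.398's mechanism).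
* ★★ **`king_covariant_what_the_curved_case_adds`** — `U(1)` links, `c > 0`: the massless covariant Laplacian is positive definite iff `U` is not a pure gauge, King's own
  massless operator is not (Ͱ-d), and in the massive case the block sizes are gauge invariant (Ͱ-b).

Locators: [King1986] (4.4) p.670, Lemma 4.5 (4.38) p.674; [Balaban1985BackgroundPropagators] (3.23) p.394, Thm 3.1 (3.42) p.397, p.398; [Balaban1982Higgs2] (3.38) p.591;
[DodziukMathai2006] §1 Lemma 1.2, Cor 1.3, Thm 1.5; [Balaban1985BackgroundPropagators] p.398 l.3–6 (random walk).  0 `sorry`, 0 `def`.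
-/

noncomputable section

open scoped BigOperators ComplexConjugate ComplexOrder Kronecker Matrix.Norms.L2Operator
open Finset Matrix WithLp

namespace Summit.QuantumFields.YangMills.BalabanUVNodes.N15KingModelRung.Covariant

open Literature.MathematicalPhysics.QuantumFieldTheory.LatticeDiamagneticInequality (Hopping blk)
open Literature.MathematicalPhysics.QuantumFieldTheory.Balaban1983to89.B5Prop11Plancherel (Tor unitVec)
open Literature.MathematicalPhysics.QuantumFieldTheory.Balaban1983to89.B4TorusKernel (periodConst)
open Literature.MathematicalPhysics.QuantumFieldTheory.King1986.Torus (lapF tdistT)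
open Summit.QuantumFields.YangMills.BalabanUVNodes.N15KingModelRung.TorusSpectral (kappaFree)

variable {d : ℕ} (K : Fin (d + 1) → ℕ) [hK : ∀ μ, NeZero (K μ)]
variable {𝕜 : Type*} [RCLike 𝕜] {n : Type*} [Fintype n] [DecidableEq n] [Nonempty n] {c m2 : ℝ}

/-- ★★★ **PART Ͱ BY NAME — WHAT DOES NOT CHANGE**: for every period vector (all periods `≥ 2`), `c ≥ 0`, `m² > 0`, every non-empty fibre and EVERY unitary link field `U`, with
`G = (lapF K c m²)⁻¹` King's `A = 0` covariance, `M_U = covLapF K c m² U`, `G_U = M_U⁻¹`: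
(1) `M_1 = lapF ⊗ₖ 1`; (2) `‖(G_U)_{xy}‖ ≤ G(x,y)`; (3) `‖(G_U)_{xy}‖ ≤ (2∕m²)·periodConst κ_F d·e^{−(κ_F∕(d+1))·tdistT K x y}`; (4) `Σ_y‖(G_U)_{xy}‖ ≤ 1∕m²`; (5) `‖G_U‖_{ℓ²→ℓ²} ≤ 1∕m²`;
(6) every eigenvalue of `M_U` lies in `[m², m²+4(d+1)c]`; (7) `|T|⁻¹ln det lapF ≤ (|n||T|)⁻¹ln Re det M_U ≤ ln(m²+2(d+1)c)`; (8) `|⟨f,G_Ug⟩| ≤ Σ‖f_x‖G(x,y)‖g_y‖`;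
(9) `‖(G_U − G_V)_{xy}‖ ≤ c·Σ_{(z,μ)}‖U(z,μ)−V(z,μ)‖·(G(x,z)G(z+e_μ,y) + G(x,z+e_μ)G(z,y))` for every second unitary field `V`;
(10) `G_U((x,i),(y,j)) = Σ_{k≥0} D₀^{−(k+1)}(T_U^k)((x,i),(y,j))`, `D₀ = m²+2(d+1)c`, `T_U` the hopping matrix (random walk representation, absolutely convergent).
[cite: King1986, (4.4) p.670, (4.38) p.674; Balaban1985BackgroundPropagators, (3.23) p.394, (3.42) p.397; Balaban1982Higgs2, (3.38) p.591; DodziukMathai2006, Thm 1.5 + Cor 1.3 §1] -/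
theorem king_covariant_domination_package (hK2 : ∀ μ, 1 < K μ) (hc : 0 ≤ c) (hm : 0 < m2)
    {U : Tor K × Fin (d + 1) → Matrix n n 𝕜} (hU : ∀ b, U b ∈ Matrix.unitaryGroup n 𝕜) :
    covLapF K c m2 (Hopping.free : Tor K × Fin (d + 1) → Matrix n n 𝕜) = (lapF K c m2).map ((↑) : ℝ → 𝕜) ⊗ₖ (1 : Matrix n n 𝕜)
    ∧ (∀ x y, ‖blk ((covLapF K c m2 U)⁻¹) x y‖ ≤ (lapF K c m2)⁻¹ x y)
    ∧ (∀ x y, ‖blk ((covLapF K c m2 U)⁻¹) x y‖ ≤ 2 / m2 * periodConst (kappaFree c m2 d) d * Real.exp (-(kappaFree c m2 d / (d + 1) * tdistT K x y)))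
    ∧ (∀ x, ∑ y, ‖blk ((covLapF K c m2 U)⁻¹) x y‖ ≤ m2⁻¹)
    ∧ ‖(covLapF K c m2 U)⁻¹‖ ≤ m2⁻¹
    ∧ (∀ i, m2 ≤ (isHermitian_covLapF K c m2 U).eigenvalues i ∧ (isHermitian_covLapF K c m2 U).eigenvalues i ≤ m2 + 4 * ((d : ℝ) + 1) * c)
    ∧ ((Fintype.card (Tor K) : ℝ)⁻¹ * Real.log (lapF K c m2).det ≤ (Fintype.card (Tor K × n) : ℝ)⁻¹ * Real.log (RCLike.re (covLapF K c m2 U).det)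
        ∧ (Fintype.card (Tor K × n) : ℝ)⁻¹ * Real.log (RCLike.re (covLapF K c m2 U).det) ≤ Real.log (m2 + 2 * ((d : ℝ) + 1) * c))
    ∧ (∀ f g : Tor K × n → 𝕜, ‖star f ⬝ᵥ ((covLapF K c m2 U)⁻¹ *ᵥ g)‖ ≤ ∑ x, ∑ y, ‖fib K f x‖ * (lapF K c m2)⁻¹ x y * ‖fib K g y‖)
    ∧ (∀ (V : Tor K × Fin (d + 1) → Matrix n n 𝕜), (∀ b, V b ∈ Matrix.unitaryGroup n 𝕜) → ∀ x y,
        ‖blk ((covLapF K c m2 U)⁻¹ - (covLapF K c m2 V)⁻¹) x y‖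
          ≤ c * ∑ z, ∑ μ, ‖U (z, μ) - V (z, μ)‖ * ((lapF K c m2)⁻¹ x z * (lapF K c m2)⁻¹ (z + unitVec K μ) y
              + (lapF K c m2)⁻¹ x (z + unitVec K μ) * (lapF K c m2)⁻¹ z y))
    ∧ (∀ x y i j, HasSum (fun k => (((m2 + 2 * ((d : ℝ) + 1) * c : ℝ) : 𝕜)⁻¹) ^ (k + 1) * ((kingHopping K c m2).hop U ^ k) (x, i) (y, j))
        ((covLapF K c m2 U)⁻¹ (x, i) (y, j))) :=
  ⟨covLapF_free_eq_kronecker K c m2,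
    fun x y => l2_opNorm_blk_inv_le K hc hm hU x y,
    fun x y => l2_opNorm_blk_inv_le_exp_tdistT K hc hm hU x y,
    fun x => sum_l2_opNorm_blk_inv_le_inv_mass K hc hm hU x,
    l2_opNorm_covLapF_inv_le K hc hm hU,
    fun i => ⟨eigenvalues_covLapF_ge_mass K hc m2 hU i, eigenvalues_covLapF_le K hc m2 hU i⟩,
    log_re_det_covLapF_div_bounds K hK2 hc hm hU,
    fun f g => norm_star_dotProduct_inv_mulVec_le K hc hm hU f g,
    fun _ hV x y => l2_opNorm_blk_inv_sub_inv_le' K hc hm hU hV x y,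
    fun x y i j => hasSum_covariant_randomWalk K hc hm hU x y i j⟩

omit [Fintype n] [DecidableEq n] [Nonempty n] in
/-- ★★ **PART Ͱ BY NAME — WHAT THE CURVED CASE ADDS** (`U(1)` links, `c > 0`): (1) the massless covariant Laplacian `−cΔ_U` is positive definite iff `U` is NOT a pure gauge
(`U ≠ kingGaugeAct g 1` for all `U(1)`-valued `g`); (2) King's own massless operator `c(−Δ) ⊗ 1` is not positive definite (the constants); (3) in the massive case the block sizes of
`G_U` are gauge invariant. [cite: DodziukMathai2006, Cor 1.3 §1; Balaban1985BackgroundPropagators, p.398; King1986, (4.4) p.670] -/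
theorem king_covariant_what_the_curved_case_adds (hc : 0 < c) (hm : 0 < m2)
    {U : Tor K × Fin (d + 1) → Matrix Unit Unit 𝕜} (hU : ∀ b, U b ∈ Matrix.unitaryGroup Unit 𝕜) :
    ((covLapF K c 0 U).PosDef ↔ ¬ ∃ g : Tor K → Matrix Unit Unit 𝕜, (∀ x, g x ∈ Matrix.unitaryGroup Unit 𝕜) ∧ U = kingGaugeAct K g Hopping.free)
    ∧ ¬ (covLapF K c 0 (Hopping.free : Tor K × Fin (d + 1) → Matrix Unit Unit 𝕜)).PosDef
    ∧ (∀ (g : Tor K → Matrix Unit Unit 𝕜), (∀ x, g x ∈ Matrix.unitaryGroup Unit 𝕜) → ∀ x y,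
        ‖blk ((covLapF K c m2 (kingGaugeAct K g U))⁻¹) x y‖ = ‖blk ((covLapF K c m2 U)⁻¹) x y‖) :=
  ⟨posDef_covLapF_massless_iff K hc hU, not_posDef_covLapF_massless_free K hc,
    fun _ hg x y => l2_opNorm_blk_inv_kingGaugeAct K hc.le hm hg hU x y⟩

end Summit.QuantumFields.YangMills.BalabanUVNodes.N15KingModelRung.Covariant

end
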